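import Summits.AtomisticToContinuum.HydrodynamicLimit.Theorems.OneFlightGossipEngineClampedCurrentsDockCubicChannelWindow
import HarnessLib

/-!
# The cubic channel in expectation under the TRUE law (stub `stub_cubicChannel`, QC-b)

Crux `Summit.AtomisticToContinuum.HydrodynamicLimit.Theses.OneFlightGossipEngine.ClampedCurrentsDock`
(stmt-AtomisticToContinuum-14680), line `IdeatorTwoSketch`, registered stub QC-b `stub_cubicChannel : CubicChannel`
(the def and its line-internal antecedents `CubicChannelPathwise` (companion file `…CubicChannelWindow`), `ThirdMomentWindow`,
`WindowFlowShift`, `CoherentSuprathermalContentVanishesW` re-declared verbatim from the line skeleton v31; `EnergyCurrentTails`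
is the route file's; finding CUTOFF-MATCHING of lead c2, `Cruxes/ClampedCurrentsDock/CUTOFF-MATCHING.md` §"The repair").

The heart pays the suprathermal heat-flux remainder `hi_s(x, v) = (b_s(x)·w) R_s(x, ‖w‖²)`, `w = v − u_s(x)`,
`b_s = ∇θ_s/(2θ_s²)`, `R_s(x, s′) = s′ − 5θ_s(x) − G_s(x, s′)`, over one window `[s, s+w]`, `w = τ(N+1)^{-1/3}`, in
expectation under `λ_N = localGibbsLaw σ a₀ u₀ θ₀ N (Φ N)`: `E_λ|∫_s^{s+w} Σ_i hi_s(Φ_r z i) dr| ≤ w (N+1) ε`.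

Proof. Fix `t`; `K⋆` is the one of the weighted coherence input S6′ at `t`. Given the cut-off `G` (bound `C_G`, agreement
below `K⋆²`) and `ε`: the slab package of the Euler solution on `[0, t]` gives `0 < θ_s ≤ θM`, `‖u_s‖ ≤ U`, `‖b_s‖ ≤ Bb`,
`b_s` `Lb`-Lipschitz; `C_R = 1 + (5θM + C_G)/K⋆²`. PATHWISE (`pathwiseWindowBound`, companion file): QC-a at the good
point `Φ_s z`, shifted back, bounds `|∫Σhi|` by `k₁ ∫Σ‖v_i‖³ + k₀ + k₃ ∫Σ 1{Mv<‖v_i‖}‖v_i‖³ + k₂ · [S6′ integrand]`.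
IN MEAN (`oneWindow`): third moments by TM fed with ECT at accuracy `1` (level `M`), cubic tails by Tonelli and ECT at
accuracy `ε″` (level `Mv − U… = max M₂ 0`), the coherent term by S6′ at the measurable radial weight
`R′ = 1{K⋆² < s′}(s′ − 5θ_{πs} − G_{πs})/C_R` (`= R_s/C_R` on `[0, t]`, `|R′| ≤ |s′|`), level `η/C_R`, accuracy `ε′`.
ORDER OF CHOICES: `M` (ECT at 1) → `η, ε′, ε″, δ` → S6′ (`τ₀`, then `N₀(τ)`) and ECT at `ε″`; the drift term carries an
extra factor `w → 0`, fixing the last `N₀(τ)`; each of the five terms is `≤ ε/8`.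

prover-line-stmt-AtomisticToContinuum-14680-c2-0 (stub worker QC-b).
-/

noncomputable section

namespace Summit.AtomisticToContinuum.HydrodynamicLimit.Theorems.ClampedCurrentsDockCubicChannel

open scoped BigOperators ENNReal Classical Interval
open MeasureTheory Filter Set Topology InformationTheory
open Literature.MathematicalPhysics.KineticTheory Literature.Analysis.FluidPDE Literature.Analysis.FunctionSpaces
open Summit.AtomisticToContinuum.HydrodynamicLimit.Theses.OneFlightGossipEngine
open Summit.AtomisticToContinuum.HydrodynamicLimit.Theorems
open Summit.AtomisticToContinuum.HydrodynamicLimit.Theorems.ClampedCurrentsDockCubicChannelPrelim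
open Summit.AtomisticToContinuum.HydrodynamicLimit.Theorems.EntropyClockDock (ae_mem_good_localGibbsLaw)
open Summit.AtomisticToContinuum.HydrodynamicLimit.Theorems.ClampedCurrentsDockCubicPathwise (abs_radialRemainder_le)

/-! ## §1 The statements (verbatim from the line skeleton v31) -/

/-- registered stub signature S6′ (antecedent of QC-b) of line IdeatorTwoSketch, crux ClampedCurrentsDock — route-internal, not a cited fact -/
def CoherentSuprathermalContentVanishesW : Prop :=
  ∀ (a₀ θ₀ : T3 → ℝ) (u₀ : T3 → V3), Continuous a₀ → Continuous θ₀ → Continuous u₀ →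
    (∀ x, 0 < a₀ x) → (∀ x, 0 < θ₀ x) →
    ∃ σ₀ : ℝ, 0 < σ₀ ∧ ∀ σ : ℝ, 0 < σ → σ < σ₀ →
    ∀ (T : ℝ) (ρ θ : ℝ → T3 → ℝ) (u : ℝ → T3 → V3), IsHardSphereEulerSolution σ T ρ u θ →
    ∀ Φ : (N : ℕ) → HardSphereFlow (Torus.geometry (Fin 3)) (hsDiameter σ N) (N + 1),
    TendstoHydroFieldsAt (fun N => localGibbsLaw σ a₀ u₀ θ₀ N (Φ N)) Φ ρ u θ 0 →
    ∀ t ∈ Set.Ico 0 T, ∃ Kstar : ℝ, 0 < Kstar ∧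
    ∀ R : ℝ → T3 → ℝ → ℝ, Measurable (fun p : ℝ × T3 × ℝ => R p.1 p.2.1 p.2.2) →
    (∀ s x s', s' ≤ Kstar ^ 2 → R s x s' = 0) → (∀ s x s', |R s x s'| ≤ |s'|) →
    ∀ η : ℝ, 0 < η → ∀ ε : ℝ, 0 < ε →
    ∃ τ₀ : ℝ, 0 < τ₀ ∧ ∀ τ : ℝ, τ₀ ≤ τ → ∃ N₀ : ℕ, ∀ N : ℕ, N₀ ≤ N → ∀ s ∈ Set.Icc 0 t,
      (let w : ℝ := τ * ((N : ℝ) + 1) ^ (-(1 / 3 : ℝ))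
       let P := localGibbsLaw σ a₀ u₀ θ₀ N (Φ N)
       let W := fun (i : Fin (N + 1)) (s r : ℝ) (z : Config (N + 1) (Fin 3) T3) =>
         ((Φ N).flow r z i).2 - u s ((Φ N).flow r z i).1
       let cub := fun (i : Fin (N + 1)) (s : ℝ) (z : Config (N + 1) (Fin 3) T3) =>
         w⁻¹ * ∫ r in s..(s + w), ‖W i s r z‖ ^ 3
       let cubHi := fun (i : Fin (N + 1)) (s : ℝ) (z : Config (N + 1) (Fin 3) T3) =>
         w⁻¹ * ∫ r in s..(s + w), (if Kstar < ‖W i s r z‖ then ‖W i s r z‖ ^ 3 else 0)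
       let qbar := fun (i : Fin (N + 1)) (s : ℝ) (z : Config (N + 1) (Fin 3) T3) =>
         w⁻¹ • ∫ r in s..(s + w), (R s ((Φ N).flow r z i).1 (‖W i s r z‖ ^ 2)) • W i s r z
       ∫⁻ z, ENNReal.ofReal (((N : ℝ) + 1)⁻¹ * ∑ i : Fin (N + 1),
              (if η * cub i s z < ‖qbar i s z‖ then cubHi i s z else 0)) ∂P ≤ ENNReal.ofReal ε)

/-- registered stub signature FS (antecedent of QC-b) of line IdeatorTwoSketch, crux ClampedCurrentsDock — route-internal, not a cited fact -/
def WindowFlowShift : Prop :=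
  ∀ (σ : ℝ) (N : ℕ) (Φ : HardSphereFlow (Torus.geometry (Fin 3)) (hsDiameter σ N) (N + 1)) (s w : ℝ),
    0 ≤ s → 0 ≤ w → ∀ z ∈ Φ.good,
      (∀ f : Config (N + 1) (Fin 3) T3 → ℝ,
          (∫ r in s..(s + w), f (Φ.flow r z)) = ∫ r in (0 : ℝ)..w, f (Φ.flow r (Φ.flow s z))) ∧
      (∀ F : HardSphereCollisionRecord (Fin 3) T3 (N + 1) → ℝ,
          Φ.collisionSum (Set.Ioc s (s + w)) (fun c => F { c with time := c.time - s }) z =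
            Φ.collisionSum (Set.Ioc 0 w) F (Φ.flow s z))

/-- registered stub signature TM (antecedent of QC-b) of line IdeatorTwoSketch, crux ClampedCurrentsDock — route-internal, not a cited fact -/
def ThirdMomentWindow : Prop :=
  ∀ (σ : ℝ) (N : ℕ) (Φ : HardSphereFlow (Torus.geometry (Fin 3)) (hsDiameter σ N) (N + 1))
    (a₀ θ₀ : T3 → ℝ) (u₀ : T3 → V3) (M s w : ℝ), 0 < σ → σ < 1 / 2 →
    Continuous a₀ → Continuous θ₀ → Continuous u₀ → (∀ x, 0 < a₀ x) → (∀ x, 0 < θ₀ x) → 0 ≤ M → 0 ≤ s → 0 ≤ w →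
    (∀ r ∈ Set.Icc s (s + w), ∫⁻ z, ENNReal.ofReal (((N : ℝ) + 1)⁻¹ * ∑ i : Fin (N + 1),
        Set.indicator {v : V3 | M < ‖v‖} (fun v => ‖v‖ ^ 3) ((Φ.flow r z i).2)) ∂(localGibbsLaw σ a₀ u₀ θ₀ N Φ) ≤
        ENNReal.ofReal 1) →
    ∫⁻ z, ENNReal.ofReal (∫ r in s..(s + w), ∑ i : Fin (N + 1), ‖(Φ.flow r z i).2‖ ^ 3)
        ∂(localGibbsLaw σ a₀ u₀ θ₀ N Φ) ≤ ENNReal.ofReal (w * ((N : ℝ) + 1) * (M ^ 3 + 1))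

/-- registered stub signature QC-b of line IdeatorTwoSketch, crux ClampedCurrentsDock — route-internal, not a cited fact -/
def CubicChannel : Prop :=
  CubicChannelPathwise → ThirdMomentWindow → WindowFlowShift →
  CoherentSuprathermalContentVanishesW → EnergyCurrentTails →
  ∀ (a₀ θ₀ : T3 → ℝ) (u₀ : T3 → V3), Continuous a₀ → Continuous θ₀ → Continuous u₀ →
    (∀ x, 0 < a₀ x) → (∀ x, 0 < θ₀ x) →
    ∃ σ₀ : ℝ, 0 < σ₀ ∧ ∀ σ : ℝ, 0 < σ → σ < σ₀ →
    ∀ (T : ℝ) (ρ θ : ℝ → T3 → ℝ) (u : ℝ → T3 → V3), IsHardSphereEulerSolution σ T ρ u θ →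
    ∀ Φ : (N : ℕ) → HardSphereFlow (Torus.geometry (Fin 3)) (hsDiameter σ N) (N + 1),
    TendstoHydroFieldsAt (fun N => localGibbsLaw σ a₀ u₀ θ₀ N (Φ N)) Φ ρ u θ 0 →
    ∀ t ∈ Set.Ico 0 T, ∃ Kstar : ℝ, 0 < Kstar ∧
    ∀ (G : ℝ → T3 × ℝ → ℝ) (C_G : ℝ), 0 ≤ C_G → ContinuousOn (Function.uncurry G) (Set.Icc 0 t ×ˢ Set.univ) →
    (∀ s ∈ Set.Icc 0 t, ∀ y : T3 × ℝ, 0 ≤ y.2 → |G s y| ≤ C_G) →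
    (∀ s ∈ Set.Icc 0 t, ∀ (x : T3) (s' : ℝ), s' ≤ Kstar ^ 2 → G s (x, s') = s' - 5 * θ s x) →
    ∀ ε : ℝ, 0 < ε → ∃ τ₀ : ℝ, 0 < τ₀ ∧ ∀ τ : ℝ, τ₀ ≤ τ → ∃ N₀ : ℕ, ∀ N : ℕ, N₀ ≤ N →
    ∀ s : ℝ, 0 ≤ s → s + τ * ((N : ℝ) + 1) ^ (-(1 / 3 : ℝ)) ≤ t →
      (let w : ℝ := τ * ((N : ℝ) + 1) ^ (-(1 / 3 : ℝ))
       let hi := fun (s : ℝ) (y : T3 × V3) =>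
         (∑ k : Fin 3, Torus.partialDeriv k (θ s) y.1 / (2 * (θ s y.1) ^ 2) * (y.2 - u s y.1) k) *
           (‖y.2 - u s y.1‖ ^ 2 - 5 * θ s y.1 - G s (y.1, ‖y.2 - u s y.1‖ ^ 2))
       ∫⁻ z, ENNReal.ofReal |∫ r in s..(s + w), ∑ i : Fin (N + 1), hi s ((Φ N).flow r z i)|
           ∂(localGibbsLaw σ a₀ u₀ θ₀ N (Φ N)) ≤
         ENNReal.ofReal (w * ((N : ℝ) + 1) * ε))

/-! ## §2 The radial weight fed to the weighted coherence input -/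

/-- The radial weight `R′(s, x, s′) = 1{K⋆² < s′} (s′ − 5θ_{π s}(x) − G_{π s}(x, s′))/C`, the time clamped to `[0, t]`
(`π s = max 0 (min s t)`) so that the weight is globally measurable. [folklore] -/
def Rweight (θ : ℝ → T3 → ℝ) (G : ℝ → T3 × ℝ → ℝ) (t Kstar C : ℝ) (s : ℝ) (x : T3) (s' : ℝ) : ℝ :=
  if Kstar ^ 2 < s' then (s' - 5 * θ (max 0 (min s t)) x - G (max 0 (min s t)) (x, s')) / C else 0

/-- The weight vanishes below `K⋆²`. [folklore] -/
theorem Rweight_of_le {θ : ℝ → T3 → ℝ} {G : ℝ → T3 × ℝ → ℝ} {t Kstar C : ℝ} (s : ℝ) (x : T3) {s' : ℝ}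
    (h : s' ≤ Kstar ^ 2) : Rweight θ G t Kstar C s x s' = 0 :=
  if_neg (not_lt.2 h)

/-- On `[0, t]` the weight is the remainder profile over `C`: `R′(s, x, s′) = (s′ − 5θ_s(x) − G_s(x, s′))/C` (below `K⋆²`
both vanish by the agreement clause of the cut-off). [folklore] -/
theorem Rweight_of_mem {θ : ℝ → T3 → ℝ} {G : ℝ → T3 × ℝ → ℝ} {t Kstar C s : ℝ} (hs : s ∈ Icc 0 t)
    (hagree : ∀ (x : T3) (s' : ℝ), s' ≤ Kstar ^ 2 → G s (x, s') = s' - 5 * θ s x) (x : T3) (s' : ℝ) :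
    Rweight θ G t Kstar C s x s' = (s' - 5 * θ s x - G s (x, s')) / C := by
  unfold Rweight
  rw [min_eq_left hs.2, max_eq_right hs.1]
  split_ifs with h
  · rfl
  · rw [hagree x s' (not_lt.1 h), sub_self, zero_div]

/-- `|R′(s, x, s′)| ≤ |s′|` for the normalisation `C = C_R = 1 + (5θM + C_G)/K⋆²` (`0 < θ ≤ θM`, `|G| ≤ C_G` on `s′ ≥ 0`,
agreement below `K⋆²`, all on `[0, t]`). [folklore] -/
theorem abs_Rweight_le {θ : ℝ → T3 → ℝ} {G : ℝ → T3 × ℝ → ℝ} {t Kstar C_G θM : ℝ} (ht : 0 ≤ t) (hK : 0 < Kstar)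
    (hCG : 0 ≤ C_G) (hθpos : ∀ s ∈ Icc 0 t, ∀ x, 0 < θ s x) (hθle : ∀ s ∈ Icc 0 t, ∀ x, θ s x ≤ θM)
    (hGb : ∀ s ∈ Icc 0 t, ∀ y : T3 × ℝ, 0 ≤ y.2 → |G s y| ≤ C_G)
    (hGa : ∀ s ∈ Icc 0 t, ∀ (x : T3) (s' : ℝ), s' ≤ Kstar ^ 2 → G s (x, s') = s' - 5 * θ s x)
    (s : ℝ) (x : T3) (s' : ℝ) :
    |Rweight θ G t Kstar (1 + (5 * θM + C_G) / Kstar ^ 2) s x s'| ≤ |s'| := by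
  unfold Rweight
  split_ifs with h
  · have hs'0 : 0 ≤ s' := (sq_nonneg Kstar).trans h.le
    have hπ : max 0 (min s t) ∈ Icc 0 t := ⟨le_max_left _ _, max_le ht (min_le_right _ _)⟩
    have hθM : 0 ≤ θM := (hθpos _ hπ x).le.trans (hθle _ hπ x)
    have hCR : 0 < 1 + (5 * θM + C_G) / Kstar ^ 2 := by positivity
    have h1 := abs_radialRemainder_le hK hCG (hθpos _ hπ) (hθle _ hπ) (hGb _ hπ)
      (hGa _ hπ) x hs'0
    rw [abs_div, abs_of_pos hCR, abs_of_nonneg hs'0]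
    exact (div_le_div_of_nonneg_right h1 hCR.le).trans_eq (mul_div_cancel_left₀ _ hCR.ne')
  · rw [abs_zero]; exact abs_nonneg _

/-- **Measurability of the radial weight** in `(s, x, s′)`: `θ` is jointly smooth on `[0, T) ⊇ [0, t]` (read through the
measurable section `reprSym` of the covering map) and `G` is jointly continuous on `[0, t] × (𝕋³ × ℝ)`; the time clamp is
continuous. [folklore] -/
theorem measurable_Rweight {T t Kstar C : ℝ} {θ : ℝ → T3 → ℝ} {G : ℝ → T3 × ℝ → ℝ}
    (hθ : Torus.IsSmoothSpaceTimeOn (Ico 0 T) θ) (ht : 0 ≤ t) (htT : t < T)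
    (hG : ContinuousOn (Function.uncurry G) (Icc 0 t ×ˢ univ)) :
    Measurable fun p : ℝ × T3 × ℝ => Rweight θ G t Kstar C p.1 p.2.1 p.2.2 := by
  have hπc : Continuous fun s : ℝ => max 0 (min s t) := continuous_const.max (continuous_id.min continuous_const)
  have hπm : ∀ s, max 0 (min s t) ∈ Icc 0 t := fun s => ⟨le_max_left _ _, max_le ht (min_le_right _ _)⟩
  have hθc : Continuous fun q : ℝ × V3 => Torus.stLift θ (max 0 (min q.1 t), q.2) :=
    hθ.continuousOn_stLift.comp_continuous ((hπc.comp continuous_fst).prodMk continuous_snd)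
      fun q => mk_mem_prod (Icc_subset_Ico_right htT (hπm q.1)) (mem_univ _)
  have hθm : Measurable fun p : ℝ × T3 × ℝ => θ (max 0 (min p.1 t)) p.2.1 := by
    have e : (fun p : ℝ × T3 × ℝ => θ (max 0 (min p.1 t)) p.2.1) =
        (fun q : ℝ × V3 => Torus.stLift θ (max 0 (min q.1 t), q.2)) ∘ fun p => (p.1, Torus.reprSym p.2.1) := by
      funext p
      simp only [Function.comp_apply, Torus.stLift_apply, Torus.proj_reprSym]
    rw [e]
    exact hθc.measurable.comp (measurable_fst.prodMk (Torus.measurable_reprSym.comp measurable_snd.fst))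
  have hGm : Measurable fun p : ℝ × T3 × ℝ => G (max 0 (min p.1 t)) (p.2.1, p.2.2) := by
    have hc : Continuous fun p : ℝ × T3 × ℝ => Function.uncurry G (max 0 (min p.1 t), p.2) :=
      hG.comp_continuous ((hπc.comp continuous_fst).prodMk continuous_snd)
        fun p => mk_mem_prod (hπm p.1) (mem_univ _)
    exact hc.measurable
  refine Measurable.ite (measurableSet_lt measurable_const measurable_snd.snd) ?_ measurable_const
  exact ((measurable_snd.snd.sub (measurable_const.mul hθm)).sub hGm).div_const _

/-! ## §3 One window in expectation -/

variable {σ : ℝ} {N : ℕ}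

/-- **One window in mean.** Under `λ = localGibbsLaw σ a₀ u₀ θ₀ N Φ`, with the frozen slices `θs, us, bs, Gs` of QC-a on
`[s, s+w]`, `C_R = 1 + (5θM + C_G)/K⋆²`: the per-time cubic tails at levels `M` (accuracy `1`) and `Mv ≥ U` (accuracy
`e″`) and the weighted coherence input at the weight `R/C_R`, level `η/C_R`, accuracy `e′`, bound
`E_λ|∫_s^{s+w} Σ_i hi(Φ_r z i)|` by `k₁ w(N+1)(M³+1) + k₀ + k₃ w(N+1)e″ + k₂ e′` with the constants of
`pathwiseWindowBound` (pathwise a.s. on the good set; TM; Tonelli for the tails; the one possibly non-measurable term, the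
coherent one, integrated last). [folklore] -/
theorem oneWindow (hQC : CubicChannelPathwise) (hTM : ThirdMomentWindow)
    (Φ : HardSphereFlow (Torus.geometry (Fin 3)) (hsDiameter σ N) (N + 1))
    {a₀ θ₀ : T3 → ℝ} {u₀ : T3 → V3} {θs : T3 → ℝ} {us bs : T3 → V3} {Gs : T3 × ℝ → ℝ}
    {Kstar C_G C_R Bb Lb U θM η s w M Mv δ e' e'' : ℝ}
    (hσ : 0 < σ) (hσ2 : σ < 1 / 2) (ha : Continuous a₀) (hθ : Continuous θ₀) (hu : Continuous u₀)
    (ha0 : ∀ x, 0 < a₀ x) (hθ0 : ∀ x, 0 < θ₀ x)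
    (hK : 0 < Kstar) (hCG : 0 ≤ C_G) (hBb : 0 ≤ Bb) (hLb : 0 ≤ Lb) (hU : 0 ≤ U) (hθM : 0 ≤ θM) (hη : 0 < η)
    (hs : 0 ≤ s) (hw : 0 < w) (hM : 0 ≤ M) (hUMv : U ≤ Mv) (hδ : 0 < δ) (he' : 0 ≤ e') (he'' : 0 ≤ e'')
    (hθc : Continuous θs) (huc : Continuous us) (hbc : Continuous bs) (hGc : Continuous Gs)
    (hθpos : ∀ x, 0 < θs x) (hθle : ∀ x, θs x ≤ θM) (hule : ∀ x, ‖us x‖ ≤ U) (hble : ∀ x, ‖bs x‖ ≤ Bb)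
    (hblip : ∀ x y : T3, ‖bs x - bs y‖ ≤ Lb * Torus.euclidDist x y)
    (hGb : ∀ y : T3 × ℝ, 0 ≤ y.2 → |Gs y| ≤ C_G)
    (hGa : ∀ (x : T3) (s' : ℝ), s' ≤ Kstar ^ 2 → Gs (x, s') = s' - 5 * θs x)
    (hCR : C_R = 1 + (5 * θM + C_G) / Kstar ^ 2)
    (hECT1 : ∀ r ∈ Icc s (s + w), ∫⁻ z, ENNReal.ofReal (((N : ℝ) + 1)⁻¹ * ∑ i : Fin (N + 1),
        Set.indicator {v : V3 | M < ‖v‖} (fun v => ‖v‖ ^ 3) ((Φ.flow r z i).2)) ∂(localGibbsLaw σ a₀ u₀ θ₀ N Φ) ≤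
        ENNReal.ofReal 1)
    (hECT2 : ∀ r ∈ Icc s (s + w), ∫⁻ z, ENNReal.ofReal (((N : ℝ) + 1)⁻¹ * ∑ i : Fin (N + 1),
        Set.indicator {v : V3 | Mv < ‖v‖} (fun v => ‖v‖ ^ 3) ((Φ.flow r z i).2)) ∂(localGibbsLaw σ a₀ u₀ θ₀ N Φ) ≤
        ENNReal.ofReal e'')
    (hS6 : ∫⁻ z, ENNReal.ofReal (((N : ℝ) + 1)⁻¹ * ∑ i : Fin (N + 1),
        (if η / C_R * (w⁻¹ * ∫ r in s..(s + w), ‖Wv Φ us z i r‖ ^ 3) <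
            ‖w⁻¹ • ∫ r in s..(s + w),
              (Rrem θs Gs (Φ.flow r z i).1 (‖Wv Φ us z i r‖ ^ 2) / C_R) • Wv Φ us z i r‖ then
          w⁻¹ * ∫ r in s..(s + w), (if Kstar < ‖Wv Φ us z i r‖ then ‖Wv Φ us z i r‖ ^ 3 else 0) else 0))
        ∂(localGibbsLaw σ a₀ u₀ θ₀ N Φ) ≤ ENNReal.ofReal e') :
    ∫⁻ z, ENNReal.ofReal |∫ r in s..(s + w), ∑ i : Fin (N + 1), hiF θs us bs Gs (Φ.flow r z i)|
        ∂(localGibbsLaw σ a₀ u₀ θ₀ N Φ) ≤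
      ENNReal.ofReal
        ((4 * (Bb * η + C_R * Lb * δ) + 2 * C_R * Bb * (w * (Mv + U) ^ 3 / δ)) * (w * ((N : ℝ) + 1) * (M ^ 3 + 1)) +
          (4 * (Bb * η + C_R * Lb * δ) * (w * ((N : ℝ) + 1) * U ^ 3) +
            2 * C_R * Bb * (w * (Mv + U) ^ 3 / δ) * (w * ((N : ℝ) + 1))) +
          16 * C_R * Bb * (w * ((N : ℝ) + 1) * e'') + Bb * C_R * (w * ((N : ℝ) + 1)) * e') := by
  subst hCR
  haveI := isProbabilityMeasure_localGibbsLaw ha hθ hu ha0 hθ0 hσ2.le N Φ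
  have hCR : 0 < 1 + (5 * θM + C_G) / Kstar ^ 2 := by positivity
  have hMU3 : 0 ≤ (Mv + U) ^ 3 := pow_nonneg (by linarith) 3
  have hwM : 0 ≤ w * (Mv + U) ^ 3 / δ := div_nonneg (mul_nonneg hw.le hMU3) hδ.le
  have hgood := ae_mem_good_localGibbsLaw σ a₀ θ₀ u₀ N Φ
  have hgood' : (localGibbsLaw σ a₀ u₀ θ₀ N Φ) Φ.goodᶜ = 0 := mem_ae_iff.1 hgood
  -- a.e.-measurability of the two measurable window functionals
  have hVm : AEMeasurable (fun z => ∫ r in s..(s + w), ∑ i : Fin (N + 1), ‖(Φ.flow r z i).2‖ ^ 3)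
      (localGibbsLaw σ a₀ u₀ θ₀ N Φ) :=
    Φ.aemeasurable_intervalIntegral_comp_flow_torus (f := fun c => ∑ i : Fin (N + 1), ‖(c i).2‖ ^ 3)
      (Finset.measurable_sum _ fun i _ => (measurable_pi_apply i).snd.norm.pow_const 3) s (s + w) hgood'
  have hTm : AEMeasurable (fun z => ∫ r in s..(s + w), ∑ i : Fin (N + 1),
      Set.indicator {v : V3 | Mv < ‖v‖} (fun v => ‖v‖ ^ 3) ((Φ.flow r z i).2)) (localGibbsLaw σ a₀ u₀ θ₀ N Φ) :=
    Φ.aemeasurable_intervalIntegral_comp_flow_torus (f := tailSum N Mv) (measurable_tailSum N Mv) s (s + w) hgood'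
  -- the three means
  have hV := hTM σ N Φ a₀ θ₀ u₀ M s w hσ hσ2 ha hθ hu ha0 hθ0 hM hs hw.le hECT1
  have hT := cubicTailWindow σ N Φ a₀ θ₀ u₀ Mv e'' s w hσ hσ2 ha hθ hu ha0 hθ0 he'' hw.le hECT2
  refine lintegral_abs_le_of_pathwise (add_nonneg (by positivity) (mul_nonneg (by positivity) hwM))
    (add_nonneg (by positivity) (mul_nonneg (mul_nonneg (by positivity) hwM) (by positivity))) (by positivity)
    (by positivity) (by positivity) (by positivity) he' hVm hTm ?_ hV hT hS6
  filter_upwards [hgood] with z hz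
  exact pathwiseWindowBound hQC σ N Φ θs us bs Gs Kstar C_G Bb Lb U θM η s w Mv δ hσ hσ2 hK hCG hBb hLb hU hθM hη hw
    hUMv hδ hθc huc hbc hGc hθpos hθle hule hble hblip hGb hGa z hz

/-! ## §4 The stub -/

/-- **STUB QC-b `stub_cubicChannel : CubicChannel`** of line `IdeatorTwoSketch` (crux `ClampedCurrentsDock`, stmt-14680):
the cubic channel of the heart in expectation under the true law, from QC-a (pathwise), TM (third moments), the weighted
coherence input S6′ and the cubic tails ECT; order of choices `M → (η, ε′, ε″, δ) → τ₀ → N₀(τ)`. [folklore] -/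
theorem stub_cubicChannel : CubicChannel := by
  intro hQC hTM _hFS hS6 hECT a₀ θ₀ u₀ ha hθ hu ha0 hθ0
  obtain ⟨σ₁, hσ₁, hS6σ⟩ := hS6 a₀ θ₀ u₀ ha hθ hu ha0 hθ0
  obtain ⟨σ₂, hσ₂, hECTσ⟩ := hECT a₀ θ₀ u₀ ha hθ hu ha0 hθ0
  refine ⟨min (min σ₁ σ₂) (1 / 2), lt_min (lt_min hσ₁ hσ₂) one_half_pos, ?_⟩
  intro σ hσ hσ0 T ρ θ u hE Φ hT0 t ht
  have hσ₁' : σ < σ₁ := hσ0.trans_le ((min_le_left _ _).trans (min_le_left _ _))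
  have hσ₂' : σ < σ₂ := hσ0.trans_le ((min_le_left _ _).trans (min_le_right _ _))
  have hσh : σ < 1 / 2 := hσ0.trans_le (min_le_right _ _)
  obtain ⟨Kstar, hK, hS6K⟩ := hS6σ σ hσ hσ₁' T ρ θ u hE Φ hT0 t ht
  have hECTt := hECTσ σ hσ hσ₂' T ρ θ u hE Φ hT0 t ht
  refine ⟨Kstar, hK, ?_⟩
  intro G C_G hCG hGc hGb hGa ε hε
  -- the slab package of the Euler solution on `[0, t]`
  obtain ⟨θM, U, Bb, Lb, hθM, hU, hBb, hLb, hslab⟩ := slab_package hE ht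
  have hθpos' : ∀ s ∈ Icc 0 t, ∀ x, 0 < θ s x := fun s hs => (hslab s hs).2.2.2.1
  have hθle' : ∀ s ∈ Icc 0 t, ∀ x, θ s x ≤ θM := fun s hs => (hslab s hs).2.2.2.2.1
  set CR : ℝ := 1 + (5 * θM + C_G) / Kstar ^ 2 with hCRdef
  have hCR : 0 < CR := by positivity
  -- third moments at accuracy 1 (level `M = max M₁ 0`) and the four small parameters
  obtain ⟨M₁, N₁, hN₁⟩ := hECTt 1 one_pos
  have hM : 0 ≤ max M₁ 0 := le_max_right _ _
  set η : ℝ := ε / (8 * (4 * Bb * (max M₁ 0 ^ 3 + 1 + U ^ 3)) + 8) with hηdef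
  have hη : 0 < η := by positivity
  set e' : ℝ := ε / (8 * (Bb * CR) + 8) with he'def
  have he' : 0 < e' := by positivity
  set e'' : ℝ := ε / (8 * (16 * CR * Bb) + 8) with he''def
  have he'' : 0 < e'' := by positivity
  set δ : ℝ := ε / (8 * (4 * CR * Lb * (max M₁ 0 ^ 3 + 1 + U ^ 3)) + 8) with hδdef
  have hδ : 0 < δ := by positivity
  -- the weighted coherence input at the weight `R′ = R/C_R`, level `η/C_R`, accuracy `e'`
  obtain ⟨τ₀, hτ₀, hS6τ⟩ := hS6K (Rweight θ G t Kstar CR)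
    (measurable_Rweight hE.smooth_temperature ht.1 ht.2 hGc) (fun s x s' h => Rweight_of_le s x h)
    (abs_Rweight_le ht.1 hK hCG hθpos' hθle' hGb hGa) (η / CR) (by positivity) e' he'
  -- cubic tails at accuracy `e''` (level `Mv = max M₂ 0 + U`)
  obtain ⟨M₂, N₂, hN₂⟩ := hECTt e'' he''
  have hMv : max M₂ 0 ≤ max M₂ 0 + U := le_add_of_nonneg_right hU
  have hUMv : U ≤ max M₂ 0 + U := le_add_of_nonneg_left (le_max_right _ _)
  refine ⟨τ₀, hτ₀, fun τ hτ => ?_⟩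
  have hτ0 : 0 < τ := hτ₀.trans_le hτ
  obtain ⟨N₃, hN₃⟩ := hS6τ τ hτ
  -- the window length vanishes: the drift constant `K₄`
  set K₄ : ℝ := 2 * CR * Bb * (max M₂ 0 + U + U) ^ 3 * (max M₁ 0 ^ 3 + 2) / δ with hK₄def
  have hK₄ : 0 ≤ K₄ := by positivity
  have hc₄ : 0 < ε / (8 * K₄ + 8) := by positivity
  obtain ⟨N₄, hN₄⟩ := eventually_atTop.1 ((tendsto_window_zero τ).eventually (Iio_mem_nhds hc₄))
  refine ⟨max (max N₁ N₂) (max N₃ N₄), fun N hN s hs0 hsw => ?_⟩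
  have hN₁N : N₁ ≤ N := le_trans (le_trans (le_max_left _ _) (le_max_left _ _)) hN
  have hN₂N : N₂ ≤ N := le_trans (le_trans (le_max_right _ _) (le_max_left _ _)) hN
  have hN₃N : N₃ ≤ N := le_trans (le_trans (le_max_left _ _) (le_max_right _ _)) hN
  have hN₄N : N₄ ≤ N := le_trans (le_trans (le_max_right _ _) (le_max_right _ _)) hN
  intro w hi
  have hw : 0 < w := mul_pos hτ0 (Real.rpow_pos_of_pos (by positivity) _)
  have hsw' : s + w ≤ t := hsw
  have hwlt : w < ε / (8 * K₄ + 8) := hN₄ N hN₄N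
  have hst : s ≤ t := by linarith
  have hsI : s ∈ Icc 0 t := ⟨hs0, hst⟩
  obtain ⟨hθc, huc, hbc, hθpos, hθle, hule, hble, hblip⟩ := hslab s hsI
  have hGsc : Continuous (G s) :=
    hGc.comp_continuous (continuous_const.prodMk continuous_id) fun y => mk_mem_prod hsI (mem_univ _)
  -- the inputs on the window
  have hECT1 : ∀ r ∈ Icc s (s + w), ∫⁻ z, ENNReal.ofReal (((N : ℝ) + 1)⁻¹ * ∑ i : Fin (N + 1),
      Set.indicator {v : V3 | max M₁ 0 < ‖v‖} (fun v => ‖v‖ ^ 3) (((Φ N).flow r z i).2))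
        ∂(localGibbsLaw σ a₀ u₀ θ₀ N (Φ N)) ≤ ENNReal.ofReal 1 := fun r hr =>
    (lintegral_tail_mono (Φ N) _ (le_max_left M₁ 0) r).trans (hN₁ N hN₁N r ⟨hs0.trans hr.1, hr.2.trans hsw'⟩)
  have hECT2 : ∀ r ∈ Icc s (s + w), ∫⁻ z, ENNReal.ofReal (((N : ℝ) + 1)⁻¹ * ∑ i : Fin (N + 1),
      Set.indicator {v : V3 | max M₂ 0 + U < ‖v‖} (fun v => ‖v‖ ^ 3) (((Φ N).flow r z i).2))
        ∂(localGibbsLaw σ a₀ u₀ θ₀ N (Φ N)) ≤ ENNReal.ofReal e'' := fun r hr =>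
    (lintegral_tail_mono (Φ N) _ ((le_max_left M₂ 0).trans hMv) r).trans
      (hN₂ N hN₂N r ⟨hs0.trans hr.1, hr.2.trans hsw'⟩)
  have hS6N := hN₃ N hN₃N s hsI
  simp only [Rweight_of_mem hsI (hGa s hsI)] at hS6N
  -- one window in mean
  have hOW := oneWindow hQC hTM (Φ N) (bs := bfield θ s) hσ hσh ha hθ hu ha0 hθ0 hK hCG hBb hLb hU hθM hη hs0 hw hM
    hUMv hδ he'.le he''.le hθc huc hbc hGsc hθpos hθle hule hble hblip (hGb s hsI) (hGa s hsI) hCRdef hECT1 hECT2 hS6N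
  refine hOW.trans (ENNReal.ofReal_le_ofReal ?_)
  -- the five small terms
  have h1 : 4 * Bb * (max M₁ 0 ^ 3 + 1 + U ^ 3) * η ≤ ε / 8 := by
    rw [hηdef]; exact mul_frac_le (by positivity) hε.le
  have h2 : Bb * CR * e' ≤ ε / 8 := by rw [he'def]; exact mul_frac_le (by positivity) hε.le
  have h3 : 16 * CR * Bb * e'' ≤ ε / 8 := by rw [he''def]; exact mul_frac_le (by positivity) hε.le
  have h4 : 4 * CR * Lb * (max M₁ 0 ^ 3 + 1 + U ^ 3) * δ ≤ ε / 8 := by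
    rw [hδdef]; exact mul_frac_le (by positivity) hε.le
  have h5 : 2 * CR * Bb * (w * (max M₂ 0 + U + U) ^ 3 / δ) * (max M₁ 0 ^ 3 + 2) ≤ ε / 8 := by
    have e : 2 * CR * Bb * (w * (max M₂ 0 + U + U) ^ 3 / δ) * (max M₁ 0 ^ 3 + 2) = K₄ * w := by
      rw [hK₄def]; ring
    rw [e]
    calc K₄ * w ≤ K₄ * (ε / (8 * K₄ + 8)) := mul_le_mul_of_nonneg_left hwlt.le hK₄
      _ ≤ ε / 8 := mul_frac_le hK₄ hε.le
  have hwN : 0 ≤ w * ((N : ℝ) + 1) := by positivity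
  calc (4 * (Bb * η + CR * Lb * δ) + 2 * CR * Bb * (w * (max M₂ 0 + U + U) ^ 3 / δ)) *
          (w * ((N : ℝ) + 1) * (max M₁ 0 ^ 3 + 1)) +
        (4 * (Bb * η + CR * Lb * δ) * (w * ((N : ℝ) + 1) * U ^ 3) +
          2 * CR * Bb * (w * (max M₂ 0 + U + U) ^ 3 / δ) * (w * ((N : ℝ) + 1))) +
        16 * CR * Bb * (w * ((N : ℝ) + 1) * e'') + Bb * CR * (w * ((N : ℝ) + 1)) * e'
      = w * ((N : ℝ) + 1) * (4 * Bb * (max M₁ 0 ^ 3 + 1 + U ^ 3) * η +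
          4 * CR * Lb * (max M₁ 0 ^ 3 + 1 + U ^ 3) * δ +
          2 * CR * Bb * (w * (max M₂ 0 + U + U) ^ 3 / δ) * (max M₁ 0 ^ 3 + 2) +
          16 * CR * Bb * e'' + Bb * CR * e') := by ring
    _ ≤ w * ((N : ℝ) + 1) * ε := mul_le_mul_of_nonneg_left (by linarith) hwN

end Summit.AtomisticToContinuum.HydrodynamicLimit.Theorems.ClampedCurrentsDockCubicChannel

end
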